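import Summits.CriticalPhenomena.SAWScalingLimit.Theorems.SAWDefectDecoherenceObservableToSLERTwoPieceAdmIdentificationFamily
import Summits.CriticalPhenomena.SAWScalingLimit.Theorems.SAWDefectDecoherenceObservableToSLERTwoPieceAdmIdentificationExclusion
import HarnessLib

/-!
# Crux `SAWDefectDecoherence.ObservableToSLER` (stmt-CriticalPhenomena-14005), line
`bridge-gate-renewal` (r7), stub 5a3 `stub_twoPieceAdmIdentification`: THE RESTRICTION SANDWICH of
a weak limit of the Duminil-Copin–Smirnov laws from the two-piece admissible restriction limit

Landing target:
`Summits/CriticalPhenomena/SAWScalingLimit/Theorems/SAWDefectDecoherenceObservableToSLERTwoPieceAdmIdentificationSandwich.lean`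
(`--supports stmt-CriticalPhenomena-14005`).  Sequel of `…Family` (admissible sub-families) and
`…Exclusion` (the exclusion set of a hull subdomain).

`sandwich_of_admRestrictionLimit`: GIVEN the two-piece admissible restriction limit (ARL″, the
conclusion of stub 5a2, as a hypothesis), a two-piece flat Dobrushin domain `(M; a, b)`, an
admissible family `Λ δ` and a probability weak limit `μ` of the DCS laws along `s n → 0⁺` (ratio
convergence), for EVERY hull subdomain `M' = φ(ℍ ∖ A)` with restriction data `(Φ_A, d = Φ'_A(0))`:
(UPPER) `d^{5/8} ≤ μ{trace ⊆ cl M'}` — the ratio `Z_{Λ'}/Z_Λ → d^{5/8}` (ARL″ on the admissible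
sub-family of `…Family` built on the exclusion set of `…Exclusion`) is the DCS probability that
all vertices lie in `Λ' δ`, an event contained in the closed event `{curve ⊆ cl B_η(M')}` for
`δ ≤ η` (closed transfer, then `η ↓ 0`); (LOWER) if `μ` is carried by the chordal carrier,
`μ{trace ∩ φ̂(A) = ∅} ≤ d^{5/8}` — the open event `{curve ∩ cl B_r(T) = ∅}` forces all vertices
into `Λ' δ` for `6δ < r` (open transfer, then `r ↓ 0`, and `{trace ∩ T = ∅} ⊇ {trace ∩ φ̂(A) = ∅}`
on the carrier since `T ∖ φ̂(A) ⊆ ∂M ∖ {a, b}`).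
-/

noncomputable section

open scoped BigOperators Topology NNReal ENNReal Classical BoundedContinuousFunction
open Filter Set MeasureTheory Metric
open Literature.Probability.LatticeModels (HexVertex hexGraph hexCenter Site polyline)
open Literature.Probability.RandomPlanarGeometry
open Literature.Probability.RandomPlanarGeometry.SAW
open UpperHalfPlane (upperHalfPlaneSet)

namespace Summit.CriticalPhenomena.SAWScalingLimit.Theorems.ObservableToSLER.TwoPiece

open Summit.CriticalPhenomena.SAWScalingLimit.Theorems.ObservableToSLE.FloorRatio

/-! ### Small set-theoretic inputs -/

/-- Flatness is inherited by smaller balls. [folklore] -/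
theorem flat_mono {Ω : Set ℂ} {p : ℂ} {ρ ρ' : ℝ} (h : Ω ∩ ball p ρ = {z : ℂ | p.im < z.im} ∩ ball p ρ)
    (hρ' : ρ' ≤ ρ) : Ω ∩ ball p ρ' = {z : ℂ | p.im < z.im} ∩ ball p ρ' := by
  have hb : ball p ρ' ⊆ ball p ρ := ball_subset_ball hρ'
  ext z
  constructor
  · rintro ⟨hz, hz'⟩
    have : z ∈ Ω ∩ ball p ρ := ⟨hz, hb hz'⟩
    rw [h] at this
    exact ⟨this.1, hz'⟩
  · rintro ⟨hz, hz'⟩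
    have : z ∈ {z : ℂ | p.im < z.im} ∩ ball p ρ := ⟨hz, hb hz'⟩
    rw [← h] at this
    exact ⟨this.1, hz'⟩

/-- `{trace ⊆ cl S} = ⋂ₖ {trace ⊆ cl B_{1/(k+1)}(S)}`. [folklore] -/
theorem rangeSubset_closure_eq_iInter (S : Set ℂ) :
    CurveClass.rangeSubset (closure S) =
      ⋂ k : ℕ, CurveClass.rangeSubset (cthickening (1 / ((k : ℝ) + 1)) S) := by
  ext c
  simp only [CurveClass.mem_rangeSubset, mem_iInter]
  constructor
  · exact fun h k => h.trans (closure_subset_cthickening _ _)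
  · intro h z hz
    rw [closure_eq_iInter_cthickening, mem_iInter₂]
    intro ε hε
    obtain ⟨k, hk⟩ := exists_nat_one_div_lt hε
    exact cthickening_mono hk.le _ (h k hz)

/-- `{trace ∩ T = ∅} = ⋃ₖ {trace ∩ cl B_{1/(k+1)}(T) = ∅}` for a closed `T` (traces are compact).
[folklore] -/
theorem rangeSubset_compl_eq_iUnion {T : Set ℂ} (hT : IsClosed T) :
    CurveClass.rangeSubset Tᶜ =
      ⋃ k : ℕ, CurveClass.rangeSubset (cthickening (1 / ((k : ℝ) + 1)) T)ᶜ := by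
  ext c
  simp only [CurveClass.mem_rangeSubset, mem_iUnion]
  constructor
  · intro h
    have hdisj : Disjoint c.range T := subset_compl_iff_disjoint_right.1 h
    obtain ⟨δ, hδ, hd⟩ := hdisj.exists_cthickenings c.isCompact_range hT
    obtain ⟨k, hk⟩ := exists_nat_one_div_lt hδ
    refine ⟨k, fun z hz hzT => ?_⟩
    exact Set.disjoint_left.1 hd (self_subset_cthickening _ hz) (cthickening_mono hk.le _ hzT)
  · rintro ⟨k, hk⟩
    exact hk.trans (compl_subset_compl.2 (self_subset_cthickening _))

/-- Two mid-edges whose rescaled midpoints tend to distinct points are eventually distinct.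
[folklore] -/
theorem eventually_ne_of_tendsto_midpoint {a b : ℝ → Sym2 HexVertex} {p q : ℂ} (hpq : p ≠ q)
    (ha : Tendsto (fun δ : ℝ => (δ : ℂ) * hexMidpoint (a δ)) (𝓝[>] 0) (𝓝 p))
    (hb : Tendsto (fun δ : ℝ => (δ : ℂ) * hexMidpoint (b δ)) (𝓝[>] 0) (𝓝 q)) :
    ∀ᶠ δ : ℝ in 𝓝[>] 0, a δ ≠ b δ := by
  have hd : 0 < dist p q := dist_pos.2 hpq
  filter_upwards [ha (ball_mem_nhds _ (half_pos hd)), hb (ball_mem_nhds _ (half_pos hd))]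
    with δ h0 h1 heq
  have h0' : dist ((δ : ℂ) * hexMidpoint (a δ)) p < dist p q / 2 := h0
  have h1' : dist ((δ : ℂ) * hexMidpoint (b δ)) q < dist p q / 2 := h1
  rw [heq] at h0'
  have := dist_triangle_left p q ((δ : ℂ) * hexMidpoint (b δ))
  linarith

/-! ### The sandwich -/

/-- **THE RESTRICTION SANDWICH FROM THE TWO-PIECE ADMISSIBLE RESTRICTION LIMIT** (see the module
docstring; the first hypothesis is ARL″ verbatim, the typed statement
`TwoPieceAdmRestrictionLimit` of the skeleton).
[cite: LawlerSchrammWerner2003Restriction, Lemma 3.2 (p. 10), transposed; LawlerSchrammWerner2004SAW, §3.4; BillingsleyCPM1999, Thm. 2.1] -/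
theorem sandwich_of_admRestrictionLimit
    (hARL : ∀ (D D' : DobrushinDomain) (ρ : ℝ) (φ : ConformalEquiv upperHalfPlaneSet D.carrier)
      (Φ : ConformalEquiv (upperHalfPlaneSet \ φ.pullbackHull D') upperHalfPlaneSet) (d : ℝ)
      (Λ Λ' : ℝ → Finset HexVertex) (m₀ m₁ m₁' : ℝ → ℤ) (a b : ℝ → Sym2 HexVertex),
      (0 < ρ ∧ ∀ i : Fin 2, D.carrier ∩ ball (D.pt i) ρ = {z : ℂ | (D.pt i).im < z.im} ∩ ball (D.pt i) ρ) →
      D.IsHullSubdomain D' → D.IsChordalUniformizing φ →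
      IsRestrictionMap (φ.pullbackHull D') Φ → HasRestrictionDeriv (φ.pullbackHull D') Φ d →
      (∀ᶠ δ : ℝ in 𝓝[>] 0,
        Λ' δ ⊆ Λ δ ∧ hexDomainSimplyConnected (Λ δ) ∧ hexDomainSimplyConnected (Λ' δ) ∧
        (hexGraph.induce (↑(Λ δ) : Set HexVertex)).Preconnected ∧
        (hexGraph.induce (↑(Λ' δ) : Set HexVertex)).Preconnected ∧
        a δ ∈ hexDomainBoundary (Λ δ) ∧ b δ ∈ hexDomainBoundary (Λ δ) ∧
        a δ ∈ hexDomainBoundary (Λ' δ) ∧ b δ ∈ hexDomainBoundary (Λ' δ) ∧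
        Nonempty (HexMidEdgeSAW (Λ' δ) (a δ) (b δ)) ∧
        (∀ v ∈ Λ δ, (δ : ℂ) * hexCenter v ∈ D.carrier) ∧
        (∀ v ∈ Λ' δ, (δ : ℂ) * hexCenter v ∈ D'.carrier) ∧
        (∀ v : HexVertex, (δ : ℂ) * hexCenter v ∈ ball (D.pt 0) ρ →
          ((v ∈ Λ δ ↔ m₀ δ ≤ v.1 1) ∧ (v ∈ Λ' δ ↔ m₀ δ ≤ v.1 1))) ∧
        (∀ v : HexVertex, (δ : ℂ) * hexCenter v ∈ ball (D.pt 1) ρ →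
          ((v ∈ Λ δ ↔ m₁ δ ≤ v.1 1) ∧ (v ∈ Λ' δ ↔ m₁' δ ≤ v.1 1)))) →
      (∀ K : Set ℂ, IsCompact K → K ⊆ D.carrier →
        ∀ᶠ δ : ℝ in 𝓝[>] 0, ∀ v : HexVertex, (δ : ℂ) * hexCenter v ∈ K → v ∈ Λ δ) →
      (∀ K : Set ℂ, IsCompact K → K ⊆ D'.carrier →
        ∀ᶠ δ : ℝ in 𝓝[>] 0, ∀ v : HexVertex, (δ : ℂ) * hexCenter v ∈ K → v ∈ Λ' δ) →
      Tendsto (fun δ : ℝ => (δ : ℂ) * hexMidpoint (a δ)) (𝓝[>] 0) (𝓝 (D.pt 0)) →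
      Tendsto (fun δ : ℝ => (δ : ℂ) * hexMidpoint (b δ)) (𝓝[>] 0) (𝓝 (D.pt 1)) →
      Tendsto (fun δ : ℝ =>
          (∑ γ : HexMidEdgeSAW (Λ' δ) (a δ) (b δ), hexCriticalFugacity ^ γ.length) /
            (∑ γ : HexMidEdgeSAW (Λ δ) (a δ) (b δ), hexCriticalFugacity ^ γ.length)) (𝓝[>] 0)
        (𝓝 (d ^ ((5 : ℝ) / 8))))
    {M : DobrushinDomain} {ρ : ℝ} {Λ : ℝ → Finset HexVertex} {m : Fin 2 → ℝ → ℤ}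
    {a b : ℝ → Sym2 HexVertex}
    (hflat : 0 < ρ ∧ ∀ i : Fin 2, M.carrier ∩ ball (M.pt i) ρ =
      {z : ℂ | (M.pt i).im < z.im} ∩ ball (M.pt i) ρ)
    (hadm : ∀ᶠ δ : ℝ in 𝓝[>] 0, hexDomainSimplyConnected (Λ δ) ∧ a δ ∈ hexDomainBoundary (Λ δ) ∧
      b δ ∈ hexDomainBoundary (Λ δ) ∧ Nonempty (HexMidEdgeSAW (Λ δ) (a δ) (b δ)) ∧
      (hexGraph.induce (↑(Λ δ) : Set HexVertex)).Preconnected ∧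
      (∀ v ∈ Λ δ, (δ : ℂ) * hexCenter v ∈ M.carrier) ∧
      (∀ i : Fin 2, ∀ v : HexVertex, (δ : ℂ) * hexCenter v ∈ ball (M.pt i) ρ →
        (v ∈ Λ δ ↔ m i δ ≤ v.1 1)))
    (hexh : ∀ K : Set ℂ, IsCompact K → K ⊆ M.carrier →
      ∀ᶠ δ : ℝ in 𝓝[>] 0, ∀ v : HexVertex, (δ : ℂ) * hexCenter v ∈ K → v ∈ Λ δ)
    (ha : Tendsto (fun δ : ℝ => (δ : ℂ) * hexMidpoint (a δ)) (𝓝[>] 0) (𝓝 (M.pt 0)))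
    (hb : Tendsto (fun δ : ℝ => (δ : ℂ) * hexMidpoint (b δ)) (𝓝[>] 0) (𝓝 (M.pt 1)))
    {μ : Measure (CurveClass ℂ)} [IsProbabilityMeasure μ] {s : ℕ → ℝ}
    (hs : Tendsto s atTop (𝓝[>] 0))
    (hconv : ∀ f : CurveClass ℂ →ᵇ ℝ,
      Tendsto (fun n =>
        (∑ γ : HexMidEdgeSAW (Λ (s n)) (a (s n)) (b (s n)),
            hexCriticalFugacity ^ γ.length * f (CurveClass.mk ⟨polyline (γ.verts.map fun v => ((s n : ℝ) : ℂ) * hexCenter v)⟩)) /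
          ∑ γ : HexMidEdgeSAW (Λ (s n)) (a (s n)) (b (s n)), hexCriticalFugacity ^ γ.length) atTop (𝓝 (∫ x, f x ∂μ)))
    {M' : DobrushinDomain} (hM' : M.IsHullSubdomain M')
    {φ : ConformalEquiv upperHalfPlaneSet M.carrier} (hφ : M.IsChordalUniformizing φ)
    {Φ : ConformalEquiv (upperHalfPlaneSet \ φ.pullbackHull M') upperHalfPlaneSet} {d : ℝ}
    (hΦ : IsRestrictionMap (φ.pullbackHull M') Φ) (hd : HasRestrictionDeriv (φ.pullbackHull M') Φ d) :
    ENNReal.ofReal (d ^ ((5 : ℝ) / 8)) ≤ μ (CurveClass.rangeSubset (closure M'.carrier)) ∧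
    ((∀ᵐ c ∂μ, c ∈ chordalCarrier M) →
      μ (CurveClass.rangeSubset (φ.boundaryExtension '' φ.pullbackHull M')ᶜ) ≤
        ENNReal.ofReal (d ^ ((5 : ℝ) / 8))) := by
  -- the exclusion set and the admissible sub-family
  obtain ⟨T, hTc, hT0, hT1, hTdiff, hTdisj, hTesc, hAT, hTsub⟩ := exists_exclusionSet hflat hM' hφ
  obtain ⟨Λ', ρ', hρ', hρ'ρ, hcl, hexh', hlow⟩ :=
    exists_admissible_subFamily hflat hM' hadm hexh ha hb hTc hT0 hT1 hTdiff hTdisj hTesc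
  have hflat' : 0 < ρ' ∧ ∀ i : Fin 2, M.carrier ∩ ball (M.pt i) ρ' =
      {z : ℂ | (M.pt i).im < z.im} ∩ ball (M.pt i) ρ' :=
    ⟨hρ', fun i => flat_mono (hflat.2 i) hρ'ρ⟩
  -- ARL″ along the sequence
  have hratio := (hARL M M' ρ' φ Φ d Λ Λ' (m 0) (m 1) (m 1) a b hflat' hM' hφ hΦ hd hcl hexh
    hexh' ha hb).comp hs
  -- eventual facts along the sequence
  have hne : ∀ᶠ n in atTop, Nonempty (HexMidEdgeSAW (Λ (s n)) (a (s n)) (b (s n))) :=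
    hs.eventually (hadm.mono fun δ h => h.2.2.2.1)
  have hab : ∀ᶠ n in atTop, a (s n) ≠ b (s n) :=
    hs.eventually (eventually_ne_of_tendsto_midpoint
      (fun h => absurd (M.pt_injective h) (by decide)) ha hb)
  have hcl' := hs.eventually hcl
  have hpos : ∀ᶠ n in atTop, 0 < s n := hs.eventually (eventually_mem_nhdsWithin)
  -- the key identity: `Z_{Λ'} = Σ_{γ ⊂ Λ, γ ⊆ Λ'} x_c^ℓ`
  have hZ' : ∀ᶠ n in atTop,
      (∑ γ : HexMidEdgeSAW (Λ' (s n)) (a (s n)) (b (s n)), hexCriticalFugacity ^ γ.length) =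
        ∑ γ : HexMidEdgeSAW (Λ (s n)) (a (s n)) (b (s n)),
          if ∀ v ∈ γ.verts, v ∈ Λ' (s n) then hexCriticalFugacity ^ γ.length else 0 := by
    filter_upwards [hcl', hab] with n hc hn
    exact (sum_ite_subset_pow_length_eq hc.1 hn hexCriticalFugacity).symm
  have hrn : Tendsto (fun n => ENNReal.ofReal
      ((∑ γ : HexMidEdgeSAW (Λ (s n)) (a (s n)) (b (s n)),
          if ∀ v ∈ γ.verts, v ∈ Λ' (s n) then hexCriticalFugacity ^ γ.length else 0) /
        ∑ γ : HexMidEdgeSAW (Λ (s n)) (a (s n)) (b (s n)), hexCriticalFugacity ^ γ.length)) atTop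
      (𝓝 (ENNReal.ofReal (d ^ ((5 : ℝ) / 8)))) := by
    refine (ENNReal.tendsto_ofReal hratio).congr' ?_
    filter_upwards [hZ'] with n hn
    simp only [Function.comp_apply, hn]
  constructor
  · -- UPPER
    have hη : ∀ η : ℝ, 0 < η → ENNReal.ofReal (d ^ ((5 : ℝ) / 8)) ≤
        μ (CurveClass.rangeSubset (cthickening η M'.carrier)) := by
      intro η hη
      have hsmall : ∀ᶠ n in atTop, s n < η := hs.eventually (by
        filter_upwards [Ioo_mem_nhdsGT hη] with δ hδ using hδ.2)
      refine le_measure_of_isClosed_of_tendsto hne hconv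
        (CurveClass.isClosed_rangeSubset isClosed_cthickening) hrn ?_
      filter_upwards [hcl', hab, hpos, hsmall] with n hc hn h0 hsn
      refine ENNReal.ofReal_le_ofReal (div_le_div_of_nonneg_right ?_ dcsMass_nonneg)
      refine Finset.sum_le_sum fun γ _ => ?_
      split_ifs with h1 h2
      · exact le_rfl
      · exact absurd ((range_latticeCurve_subset_cthickening_of_subset h0.le hc.2.2.2.2.2.2.2.2.2.2.2.1
          hn γ h1).trans (cthickening_mono hsn.le _)) h2
      · exact pow_nonneg hexCriticalFugacity_pos_lt_one.1.le _
      · exact le_rfl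
    rw [rangeSubset_closure_eq_iInter, Antitone.measure_iInter]
    · exact le_iInf fun k => hη _ Nat.one_div_pos_of_nat
    · intro k l hkl
      exact fun c hc => (show c.range ⊆ _ from hc).trans (cthickening_mono
        (one_div_le_one_div_of_le (by positivity) (by exact_mod_cast Nat.add_le_add_right hkl 1)) _)
    · exact fun k => (CurveClass.isClosed_rangeSubset isClosed_cthickening).measurableSet.nullMeasurableSet
    · exact ⟨0, measure_ne_top _ _⟩
  · -- LOWER
    intro hcar
    have hr : ∀ r : ℝ, 0 < r →
        μ (CurveClass.rangeSubset (cthickening r T)ᶜ) ≤ ENNReal.ofReal (d ^ ((5 : ℝ) / 8)) := by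
      intro r hr
      refine measure_le_of_isOpen_of_ratio hne hconv
        (CurveClass.isOpen_rangeSubset isClosed_cthickening.isOpen_compl) hrn ?_
      filter_upwards [hs.eventually (hlow r hr), hpos] with n hn h0
      refine ENNReal.ofReal_le_ofReal (div_le_div_of_nonneg_right ?_ dcsMass_nonneg)
      refine Finset.sum_le_sum fun γ _ => ?_
      split_ifs with h1 h2
      · exact le_rfl
      · refine absurd (hn γ (fun v hv y hy => ?_)) h2
        by_contra hlt
        push Not at hlt
        exact (show (CurveClass.mk ⟨polyline (γ.verts.map fun v => ((s n : ℝ) : ℂ) * hexCenter v)⟩).range ⊆ _ from h1) (mem_range_latticeCurve hv)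
          (mem_cthickening_of_dist_le _ y r T hy hlt.le)
      · exact pow_nonneg hexCriticalFugacity_pos_lt_one.1.le _
      · exact le_rfl
    calc μ (CurveClass.rangeSubset (φ.boundaryExtension '' φ.pullbackHull M')ᶜ)
        ≤ μ (CurveClass.rangeSubset Tᶜ) := by
          refine measure_mono_ae ?_
          filter_upwards [hcar] with c hc hV z hz hzT
          rcases hTsub hzT with hzA | ⟨hzfr, hzab⟩
          · exact hV hz hzA
          · rcases hc.2 hz with hzM | hz01
            · exact M.toJordanDomain.notMem_frontier_of_mem hzM hzfr
            · exact hzab hz01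
      _ = μ (⋃ k : ℕ, CurveClass.rangeSubset (cthickening (1 / ((k : ℝ) + 1)) T)ᶜ) := by
          rw [rangeSubset_compl_eq_iUnion hTc.isClosed]
      _ = ⨆ k : ℕ, μ (CurveClass.rangeSubset (cthickening (1 / ((k : ℝ) + 1)) T)ᶜ) := by
          refine Monotone.measure_iUnion fun k l hkl c hc => ?_
          exact (show c.range ⊆ _ from hc).trans (compl_subset_compl.2 (cthickening_mono
            (one_div_le_one_div_of_le (by positivity) (by exact_mod_cast Nat.add_le_add_right hkl 1)) _))
      _ ≤ ENNReal.ofReal (d ^ ((5 : ℝ) / 8)) := iSup_le fun k => hr _ Nat.one_div_pos_of_nat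

/-! ### Registry form -/

/-- **Registered sub-goal `stub_twoPieceAdmIdentification_avoidEvent`** (crux item
stmt-CriticalPhenomena-14005, line `bridge-gate-renewal`, stub `stub_twoPieceAdmIdentification`):
registry form of `rangeSubset_compl_eq_iUnion` — the avoidance event of a closed set is the
increasing union of the avoidance events of its closed neighbourhoods (the `r ↓ 0` step of the
lower sandwich bound; the main theorem of this file, `sandwich_of_admRestrictionLimit`, exceeds
the registry's signature size). [folklore] -/
theorem stub_twoPieceAdmIdentification_avoidEvent :
    ∀ (T : Set ℂ), IsClosed T → CurveClass.rangeSubset Tᶜ =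
      ⋃ k : ℕ, CurveClass.rangeSubset (cthickening (1 / ((k : ℝ) + 1)) T)ᶜ :=
  fun _ hT => rangeSubset_compl_eq_iUnion hT

end Summit.CriticalPhenomena.SAWScalingLimit.Theorems.ObservableToSLER.TwoPiece

end
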